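import Literature.Topology.FourManifolds.HandleRegion
import HarnessLib

/-!
# Backward flow at unit speed off the trap region of a handle chart

Topic `Literature/Topology/FourManifolds` (fact seat
`provefact-Literature.Topology.FourManifolds.IsHandlebody.exists_isBoundaryGluing_sphere`, step F2b of
the Lickorish–Wallace DAG; flow layer of the handle-extension step of the classification of
handlebodies).  Everything here is **proved**; no named facts.

Milnor, *Lectures on the h-cobordism theorem* (1965), proof of Thm. 3.4 (PDF p. 13): with
`ξ̂(f) ≡ 1`, "the integral curve through `q` … `f(ψ_q(t)) = t + const`", so that following the
trajectories backwards for time `s` lowers `f` by exactly `s` and lands on a prescribed level.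
In the handle-extension step the field `X` has `X(f) = 1` on the slab `f⁻¹[ℓ₁, ℓ₂]` **except in
the core** `W = {‖u‖ < 2r}` of the handle chart (`HandleStageField.lean`).  This file shows that
the backward orbit of a point `x` of the slab *outside the trap region*
`N₀ = D.region ε γ₀ ℓ⁻ ℓ⁺ ⊇ W` (`HandleRegion.lean`) never meets the core, hence descends at
unit speed:

* `IsFlowOf.hasDerivAt_apply_neg` — `d/ds f(θ(-s, x)) = -X(f)(θ(-s, x))`;
* `IsFlowOf.apply_neg_eq_sub` — **`f (θ (-s, x)) = f x - s` for `0 ≤ s ≤ T`**, together with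
  `θ (-s, x) ∉ W`, for `x ∉ N₀` with `ℓ₁ < f x - T`, `f x ≤ ℓ⁺ < ℓ₂`: real induction on `s`
  (`IsClosed.Icc_subset_of_forall_mem_nhdsGT_of_Icc_subset`); while the level is `≥ ℓ⁻` the
  orbit stays out of `N₀` by the invariance of the region
  (`IsFlowOf.mem_region_iff_of_forall_apply_mem`), below `ℓ⁻` it is below the core.

## References

* J. Milnor, *Lectures on the h-cobordism theorem* (1965), proof of Thm. 3.4 (PDF p. 13) and of
  Thm. 3.13 (PDF p. 18). [MilnorHCobordism1965]
-/

open scoped Manifold ContDiff Topology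
open Set Function Filter Metric

noncomputable section

namespace Literature.Topology.FourManifolds

universe u

variable {m : ℕ} {H : Type*} [TopologicalSpace H] {J : ModelWithCorners ℝ (EuclideanSpace ℝ (Fin m)) H}
  {M : Type u} [TopologicalSpace M] [ChartedSpace H M]
  {f : M → ℝ} {X : Π x : M, TangentSpace J x} {θ : ℝ × M → M} {p : M}

/-- **`d/ds f(θ(-s, x)) = -X(f)(θ(-s, x))`** (Milnor's `df/dt = ξ(f)` read backwards).
[cite: MilnorHCobordism1965, proof of Thm. 3.4 (PDF p. 13)] -/
theorem IsFlowOf.hasDerivAt_apply_neg (h : IsFlowOf J X θ) (hf : ContMDiff J 𝓘(ℝ, ℝ) ∞ f) (x : M)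
    (s : ℝ) : HasDerivAt (fun s => f (θ (-s, x)))
      (-mlineDeriv J f (θ (-s, x)) (X (θ (-s, x)))) s := by
  have h1 := h.hasDerivAt_apply hf x (-s)
  have h2 : HasDerivAt (fun s => f (θ (-s, x)))
      ((-1 : ℝ) • mlineDeriv J f (θ (-s, x)) (X (θ (-s, x)))) s := h1.scomp s (hasDerivAt_neg s)
  rwa [neg_one_smul] at h2

namespace HandleChart

variable (D : HandleChart J f X p)

/-- **The core** `W = {q ∈ φ.source | ‖u‖ < 2r}` of a handle chart: where the field is not of
unit speed. [cite: MilnorHCobordism1965, Def. 3.1] -/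
def core : Set M := {q | q ∈ D.chart.source ∧ ‖D.coord q‖ < 2 * D.r}

/-- Levels of the core: `|f - f p| < 4r²`. [cite: MilnorHCobordism1965, Def. 3.1] -/
theorem abs_sub_lt_of_mem_core {q : M} (hq : q ∈ D.core) : |f q - f p| < 4 * D.r ^ 2 := by
  have hfq := D.apply_eq_sq hq.1
  have hA := sqSumLT_le_norm_sq (m := m) D.k (D.coord q)
  have hB := sqSumGE_le_norm_sq (m := m) D.k (D.coord q)
  have hA0 := sqSumLT_nonneg (m := m) D.k (D.coord q)
  have hB0 := sqSumGE_nonneg (m := m) D.k (D.coord q)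
  have hn : ‖D.coord q‖ ^ 2 < 4 * D.r ^ 2 := by
    have := norm_nonneg (D.coord q); have := D.r_pos; nlinarith [hq.2]
  rw [abs_lt]; constructor <;> nlinarith

/-- **The core lies in every region large enough**: `W ⊆ D.region ε γ₀ ℓ⁻ ℓ⁺` as soon as
`2r < ε`, `4r⁴ ≤ γ₀`, `ℓ⁻ ≤ f p - 4r²`, `f p + 4r² ≤ ℓ⁺`. [folklore] -/
theorem core_subset_region {ε γ₀ ℓl ℓu : ℝ} (hε : 2 * D.r < ε) (hγ : 4 * D.r ^ 4 ≤ γ₀)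
    (hl : ℓl ≤ f p - 4 * D.r ^ 2) (hu : f p + 4 * D.r ^ 2 ≤ ℓu) :
    D.core ⊆ D.region ε γ₀ ℓl ℓu := by
  intro q hq
  have hlev := D.abs_sub_lt_of_mem_core hq
  rw [abs_lt] at hlev
  refine D.mem_region_of_norm_le (ρ := 2 * D.r) (by have := D.r_pos; positivity) hε ?_ hq.1 hq.2.le
    ⟨by linarith, by linarith⟩
  nlinarith

end HandleChart

/-- **Backward flow at unit speed off the trap region.**  Let `X(f) = 1` on `f⁻¹[ℓ₁, ℓ₂]` off
the core `W` of the handle chart `D`, and let `N₀ = D.region ε γ₀ ℓ⁻ ℓ⁺` be closed, containing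
`W`, with `W` strictly above the level `ℓ⁻`.  If `x ∉ N₀`, `f x ≤ ℓ⁺ < ℓ₂` and
`ℓ₁ < f x - T`, `0 ≤ T`, then for all `s ∈ [0, T]`: `f (θ (-s, x)) = f x - s` and
`θ (-s, x) ∉ W` (Milnor, proof of Thm. 3.4: `f(ψ(t)) = t + const` along the normalised field;
here the orbit is kept away from the non-normalised core by the invariance of `N₀`).
[cite: MilnorHCobordism1965, proof of Thm. 3.4 (PDF p. 13)] -/
theorem IsFlowOf.apply_neg_eq_sub (h : IsFlowOf J X θ) (D : HandleChart J f X p)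
    (hf : ContMDiff J 𝓘(ℝ, ℝ) ∞ f) {ℓ₁ ℓ₂ ε γ₀ ℓl ℓu : ℝ}
    (hunit : ∀ x, f x ∈ Icc ℓ₁ ℓ₂ → x ∉ D.core → mlineDeriv J f x (X x) = 1)
    (hN₀ : IsClosed (D.region ε γ₀ ℓl ℓu)) (hW : D.core ⊆ D.region ε γ₀ ℓl ℓu)
    (hWl : ∀ q ∈ D.core, ℓl < f q) (hu₂ : ℓu < ℓ₂)
    {x : M} (hx : x ∉ D.region ε γ₀ ℓl ℓu) (hxu : f x ≤ ℓu) {T : ℝ} (hT : 0 ≤ T)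
    (hT₁ : ℓ₁ < f x - T) {s : ℝ} (hs : s ∈ Icc 0 T) :
    f (θ (-s, x)) = f x - s ∧ θ (-s, x) ∉ D.core := by
  set N₀ := D.region ε γ₀ ℓl ℓu with hN₀_def
  set S : Set ℝ := {s | f (θ (-s, x)) = f x - s} with hS
  have hcont : Continuous fun s : ℝ => f (θ (-s, x)) :=
    hf.continuous.comp ((h.continuous_orbit x).comp continuous_neg)
  have hSc : IsClosed S := isClosed_eq hcont (continuous_const.sub continuous_id)
  -- consequence of the level law on an initial segment: the orbit avoids the core
  have havoid : ∀ t, 0 ≤ t → Icc 0 t ⊆ S → ∀ s ∈ Icc 0 t, θ (-s, x) ∉ D.core := by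
    intro t ht hseg s hs' hcore
    have hlev : ∀ s' ∈ Icc 0 t, f (θ (-s', x)) = f x - s' := fun s' hs'' => hseg hs''
    -- the level at time `-s` is above `ℓl`, so all levels on `[0, s]` are in `[ℓl, ℓu]`
    have hls : ℓl < f (θ (-s, x)) := hWl _ hcore
    rw [hlev s hs'] at hls
    have hband : ∀ t' ∈ Icc (-s) 0, f (θ (t', x)) ∈ Icc ℓl ℓu := by
      intro t' ht''
      have h1 := hlev (-t') ⟨by linarith [ht''.2], by linarith [ht''.1, hs'.2]⟩
      rw [neg_neg] at h1
      rw [h1]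
      constructor <;> linarith [ht''.1, ht''.2]
    have hiff := h.mem_region_iff_of_forall_apply_mem D hN₀ hband (t := -s) (t' := 0)
      ⟨le_rfl, by linarith [hs'.1]⟩ ⟨by linarith [hs'.1], le_rfl⟩
    rw [h.map_zero] at hiff
    exact hx (hiff.1 (hW hcore))
  -- real induction
  have hsub : Icc 0 T ⊆ S := by
    refine hSc.inter isClosed_Icc |>.Icc_subset_of_forall_mem_nhdsGT_of_Icc_subset
      (show (0 : ℝ) ∈ S by simp [hS, h.map_zero]) fun t ht hseg => ?_
    -- at the frontier time `t` the orbit point is off the closed set `N₀ ∪ {f ≤ ℓ ...}`: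
    -- find an open neighbourhood of `θ(-t, x)` free of the core
    have hlevt : f (θ (-t, x)) = f x - t := hseg (right_mem_Icc.2 ht.1)
    obtain ⟨O, hOo, hO, hOW⟩ : ∃ O : Set M, IsOpen O ∧ θ (-t, x) ∈ O ∧ ∀ q ∈ O, q ∉ D.core := by
      by_cases hcase : ℓl ≤ f x - t
      · -- the orbit point is outside `N₀`
        have hband : ∀ t' ∈ Icc (-t) 0, f (θ (t', x)) ∈ Icc ℓl ℓu := by
          intro t' ht''
          have h1 := hseg (show -t' ∈ Icc 0 t from ⟨by linarith [ht''.2], by linarith [ht''.1]⟩)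
          simp only [hS, mem_setOf_eq, neg_neg] at h1
          rw [h1]; constructor <;> linarith [ht''.1, ht''.2]
        have hiff := h.mem_region_iff_of_forall_apply_mem D hN₀ hband (t := -t) (t' := 0)
          ⟨le_rfl, by linarith [ht.1]⟩ ⟨by linarith [ht.1], le_rfl⟩
        rw [h.map_zero] at hiff
        have hnot : θ (-t, x) ∉ N₀ := fun hm => hx (hiff.1 hm)
        exact ⟨N₀ᶜ, hN₀.isOpen_compl, hnot, fun q hq hqW => hq (hW hqW)⟩
      · -- the orbit point is below the core
        push Not at hcase
        refine ⟨{q | f q < ℓl}, isOpen_lt hf.continuous continuous_const, ?_, fun q hq hqW => ?_⟩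
        · show f (θ (-t, x)) < ℓl
          rw [hlevt]; exact hcase
        · exact absurd (hWl q hqW) (not_lt.2 (le_of_lt hq))
    -- near `t`, the orbit stays in `O` and in the slab, where the speed is `1`
    have hU : IsOpen {q : M | q ∈ O ∧ f q ∈ Ioo ℓ₁ ℓ₂} :=
      hOo.inter ((isOpen_Ioo.preimage hf.continuous))
    have hmemU : θ (-t, x) ∈ {q : M | q ∈ O ∧ f q ∈ Ioo ℓ₁ ℓ₂} := by
      refine ⟨hO, ?_⟩
      show f (θ (-t, x)) ∈ Ioo ℓ₁ ℓ₂
      rw [hlevt]; exact ⟨by linarith [ht.2], by linarith [ht.1]⟩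
    have hev : ∀ᶠ s in 𝓝 t, θ (-s, x) ∈ {q : M | q ∈ O ∧ f q ∈ Ioo ℓ₁ ℓ₂} :=
      ((h.continuous_orbit x).comp continuous_neg).continuousAt.eventually (hU.mem_nhds hmemU)
    obtain ⟨δ, hδ, hballδ⟩ := Metric.eventually_nhds_iff_ball.1 hev
    -- on `[t, t + δ)` the function `s ↦ f(θ(-s, x)) + s` has zero derivative
    have hderiv : ∀ s ∈ Ico t (t + δ), HasDerivAt (fun s => f (θ (-s, x)) + s) 0 s := by
      intro s hs'
      have hsU := hballδ s (by rw [Metric.mem_ball, Real.dist_eq, abs_lt]; constructor <;> linarith [hs'.1, hs'.2])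
      have h1 := h.hasDerivAt_apply_neg hf x s
      have hspeed : mlineDeriv J f (θ (-s, x)) (X (θ (-s, x))) = 1 :=
        hunit _ ⟨hsU.2.1.le, hsU.2.2.le⟩ (hOW _ hsU.1)
      rw [hspeed] at h1
      have h2 : HasDerivAt (fun s => f (θ (-s, x)) + s) (-1 + 1) s := h1.add (hasDerivAt_id s)
      rwa [show (-1 : ℝ) + 1 = 0 by norm_num] at h2
    have hconst : ∀ s ∈ Icc t (t + δ / 2), f (θ (-s, x)) + s = f (θ (-t, x)) + t := by
      intro s hs'
      have hcont' : ContinuousOn (fun s => f (θ (-s, x)) + s) (Icc t (t + δ / 2)) :=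
        (hcont.add continuous_id).continuousOn
      exact constant_of_has_deriv_right_zero hcont'
        (fun s hs'' => (hderiv s ⟨hs''.1, by linarith [hs''.2]⟩).hasDerivWithinAt) s hs'
    have hmem : ∀ s ∈ Icc t (t + δ / 2), s ∈ S := by
      intro s hs'
      show f (θ (-s, x)) = f x - s
      have := hconst s hs'
      rw [hlevt] at this
      linarith
    exact mem_nhdsWithin.2 ⟨Iio (t + δ / 2), isOpen_Iio, by show t < t + δ / 2; linarith,
      fun s hs' => hmem s ⟨le_of_lt hs'.2, le_of_lt hs'.1⟩⟩
  exact ⟨hsub hs, havoid T hT hsub s hs⟩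

end Literature.Topology.FourManifolds
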